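import Literature.MathematicalPhysics.QuantumLattice.YangMillsHeatFlowGradientBochner
import Literature.MathematicalPhysics.QuantumLattice.YangMillsHeatFlowEpsilonRegularity
import HarnessLib

/-!
# The localized space-time `L²` bound for `∇_A F` along the Yang–Mills heat flow

QuantumLattice support file (everything proved; no definitions, no named facts) on the proof
path of `Literature.MathematicalPhysics.QuantumLattice.Waldron2019_yangMillsFlow_flatTorus`
(A. Waldron, Invent. math. 217 (2019)), §3: the energy-estimate half of the `k = 1` derivative
estimate in the `ε`-regularity Proposition 3.1(a). Integrating the Bochner identity
`∂ₜe − Δe = −N + 2∑⟨F,[F,F]⟩` (`N = ∑_{ijk}‖DᵢF_{jk}‖²`, `deriv_ymDensityOfBasis_sub_laplacian_eq`)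
against `φ²` and by parts (`∫ φ²Δe ≤ ½∫φ²N + 4∫ e‖∇φ‖²`, `integral_sq_mul_laplacian_ymDensity_le`)
gives, at each time, `∫ φ²N ≤ −2 (d/dt)∫φ²e + 8K²∫_U e + 2A₃ S ∫φ²e` (`‖∇φ‖ ≤ K`, `∇φ = 0` off
`U`, `√e ≤ S` on the support of `φ`, `A₃ = 8√2 (card ι)³`), and integrating in time:

* `hasDerivAt_integral_sq_mul_ymDensity_of_flow_on` — `d/dt ∫ φ²e = ∫ φ² ∂ₜe` along the flow;
* `integral_sq_mul_gradDensity_le_of_flow_on` — the fixed-time inequality;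
* `intervalIntegral_integral_sq_mul_gradDensity_le` — **the space-time bound**
  `∫_{t₁}^{t₂}∫ φ²N ≤ 2∫φ²e(t₁) + 8K² ∫_{t₁}^{t₂}∫_U e + 2A₃S ∫_{t₁}^{t₂}∫ φ²e`.

References: A. Waldron, Invent. math. 217 (2019), Prop. 3.1(a) [Waldron2019]; A. Waldron,
Calc. Var. PDE 55 (2016), Lemma 3.1 [Waldron2016].
-/

noncomputable section

open scoped ContDiff Topology RealInnerProductSpace Matrix NNReal ENNReal
open Set Filter MeasureTheory Metric

namespace Literature.MathematicalPhysics.QuantumLattice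

section GradEnergy

open scoped Matrix.Norms.Frobenius

attribute [local instance] frobeniusInnerProductSpace

variable {m : Type*} [Fintype m] [DecidableEq m]
variable {E : Type*} [NormedAddCommGroup E] [InnerProductSpace ℝ E] [FiniteDimensional ℝ E]
  [MeasurableSpace E] [BorelSpace E]
variable {ι : Type*} [Fintype ι] [LinearOrder ι]

/-- Finite differentiability orders are below `∞`. [folklore] -/
private theorem natCast_le_infty₈ (n : ℕ) : (n : WithTop ℕ∞) ≤ (⊤ : ℕ∞) := by
  exact_mod_cast le_top

omit [FiniteDimensional ℝ E] [MeasurableSpace E] [BorelSpace E] [LinearOrder ι] in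
/-- **Joint smoothness of the covariant derivatives of the curvature**
`(t, y) ↦ D_w F(t)(u, v)(y)` on an open time set. [folklore] -/
theorem contDiffOn_covDeriv_curvature_joint {A : ℝ → Connection E (Matrix m m ℂ)} {𝒯 : Set ℝ}
    (h𝒯 : IsOpen 𝒯) (hA : ContDiffOn ℝ ∞ (fun p : ℝ × E => A p.1 p.2) (𝒯 ×ˢ (univ : Set E)))
    (u v w : E) :
    ContDiffOn ℝ ∞ (fun p : ℝ × E =>
      covDeriv (A p.1) (fun z => curvature (A p.1) z u v) p.2 w) (𝒯 ×ˢ (univ : Set E)) := by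
  have hU : IsOpen (𝒯 ×ˢ (univ : Set E)) := h𝒯.prod isOpen_univ
  have hΦ : ContDiffOn ℝ ∞ (fun p : ℝ × E => curvature (A p.1) p.2 u v) (𝒯 ×ˢ (univ : Set E)) :=
    contDiffOn_curvature_joint hU hA (m := ∞) (by norm_cast) u v
  have hΦ' : ContDiffOn ℝ ∞ (fun p : ℝ × E =>
      fderiv ℝ (fun p : ℝ × E => curvature (A p.1) p.2 u v) p ((0 : ℝ), w))
      (𝒯 ×ˢ (univ : Set E)) :=
    ((hΦ.fderiv_of_isOpen hU (m := ∞) (by norm_cast)).clm_apply contDiffOn_const)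
  have hAw : ContDiffOn ℝ ∞ (fun p : ℝ × E => A p.1 p.2 w) (𝒯 ×ˢ (univ : Set E)) :=
    hA.clm_apply contDiffOn_const
  have hbr : ContDiffOn ℝ ∞ (fun p : ℝ × E => ⁅A p.1 p.2 w, curvature (A p.1) p.2 u v⁆)
      (𝒯 ×ˢ (univ : Set E)) := by
    have h := (hAw.mul hΦ).sub (hΦ.mul hAw)
    simp only [Ring.lie_def]
    exact h
  refine (hΦ'.add hbr).congr fun p hp => ?_
  obtain ⟨t, y⟩ := p
  change covDeriv (A t) (fun z => curvature (A t) z u v) y w = _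
  unfold covDeriv
  rw [fderiv_spaceSlice_apply hU hΦ (by simp) hp w]
  rfl

/-- **Differentiating the localized energy along the flow**: for a continuous compactly supported
weight `ψ` and `t ∈ 𝒯`, `d/ds ∫ ψ e(s) |_{s=t} = ∫ ψ ∂ₜe(t, ·)` where `∂ₜe(t, y)` is the time
derivative of the jointly smooth density (dominated convergence on the slab). [folklore] -/
theorem hasDerivAt_integral_mul_ymDensity_of_isOpen (b : OrthonormalBasis ι ℝ E)
    {A : ℝ → Connection E (Matrix m m ℂ)} {𝒯 : Set ℝ} (h𝒯 : IsOpen 𝒯)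
    (hA : ContDiffOn ℝ ∞ (fun p : ℝ × E => A p.1 p.2) (𝒯 ×ˢ (univ : Set E)))
    {ψ : E → ℝ} (hψ : Continuous ψ) (hψc : HasCompactSupport ψ) {t : ℝ} (ht : t ∈ 𝒯) :
    HasDerivAt (fun s => ∫ y, ψ y * ymDensityOfBasis b (A s) y)
      (∫ y, ψ y * deriv (fun s => ymDensityOfBasis b (A s) y) t) t := by
  have hO : IsOpen (𝒯 ×ˢ (univ : Set E)) := h𝒯.prod isOpen_univ
  have he := contDiffOn_ymDensityOfBasis_joint_infty b h𝒯 hA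
  set ē : ℝ × E → ℝ := fun p => ymDensityOfBasis b (A p.1) p.2 with hē
  set rate : ℝ × E → ℝ := fun p => fderiv ℝ ē p ((1 : ℝ), (0 : E)) with hrate
  have hrate_c : ContinuousOn rate (𝒯 ×ˢ (univ : Set E)) :=
    ((ContinuousLinearMap.apply ℝ ℝ ((1 : ℝ), (0 : E))).continuous.comp_continuousOn
      (he.continuousOn_fderiv_of_isOpen hO (by simp)))
  have hderiv : ∀ s ∈ 𝒯, ∀ y, HasDerivAt (fun s' => ē (s', y)) (rate (s, y)) s := fun s hs y =>
    hasDerivAt_timeSlice hO he (by simp) ⟨hs, mem_univ y⟩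
  have h := hasDerivAt_integral_mul_of_hasDerivAt_slab h𝒯 he.continuousOn hrate_c hderiv hψ hψc ht
  have hrate_eq : ∀ y, rate (t, y) = deriv (fun s => ymDensityOfBasis b (A s) y) t := fun y =>
    ((hderiv t ht y).deriv).symm
  simp only [hrate_eq] at h
  exact h

omit [FiniteDimensional ℝ E] [MeasurableSpace E] [BorelSpace E] in
/-- The time derivative `y ↦ ∂ₜe(t, y)` of the density is continuous in space (it is a value of
the joint Fréchet derivative). [folklore] -/
theorem continuous_deriv_ymDensity_tslice (b : OrthonormalBasis ι ℝ E)
    {A : ℝ → Connection E (Matrix m m ℂ)} {𝒯 : Set ℝ} (h𝒯 : IsOpen 𝒯)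
    (hA : ContDiffOn ℝ ∞ (fun p : ℝ × E => A p.1 p.2) (𝒯 ×ˢ (univ : Set E))) {t : ℝ} (ht : t ∈ 𝒯) :
    Continuous fun y => deriv (fun s => ymDensityOfBasis b (A s) y) t := by
  have hO : IsOpen (𝒯 ×ˢ (univ : Set E)) := h𝒯.prod isOpen_univ
  have he := contDiffOn_ymDensityOfBasis_joint_infty b h𝒯 hA
  set ē : ℝ × E → ℝ := fun p => ymDensityOfBasis b (A p.1) p.2 with hē
  have hrate_c : ContinuousOn (fun p : ℝ × E => fderiv ℝ ē p ((1 : ℝ), (0 : E)))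
      (𝒯 ×ˢ (univ : Set E)) :=
    ((ContinuousLinearMap.apply ℝ ℝ ((1 : ℝ), (0 : E))).continuous.comp_continuousOn
      (he.continuousOn_fderiv_of_isOpen hO (by simp)))
  have heq : (fun y => deriv (fun s => ymDensityOfBasis b (A s) y) t) =
      fun y => fderiv ℝ ē (t, y) ((1 : ℝ), (0 : E)) :=
    funext fun y => (hasDerivAt_timeSlice hO he (by simp) ⟨ht, mem_univ y⟩).deriv
  rw [heq]
  exact continuous_slice_of_continuousOn_slab hrate_c ht

/-- **The fixed-time inequality.** Along a jointly smooth `𝔲(m)`-valued solution of the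
Yang–Mills heat equation on the open time set `𝒯 ∋ t`, for a `C¹` compactly supported cut-off
`φ` with `‖∇φ‖ ≤ K`, `∇φ = 0` off the measurable set `U ⊆ K_c` (compact), and a bound
`√e(t, y) ≤ S` on `{φ ≠ 0}`: with `N = ∑_{ijk}‖DᵢF_{jk}‖²` and `A₃ = 8√2 (card ι)³`,
`∫ φ²N(t) ≤ −2 ∫ φ² ∂ₜe(t) + 8K² ∫_U e(t) + 2A₃S ∫ φ²e(t)` (no sign condition on
`φ` is needed at a fixed time) (the Bochner inequality `∂ₜe − Δe ≤ −N + A₃ e^{3/2}` against `φ²`, and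
`∫φ²Δe ≤ ½∫φ²N + 4∫e‖∇φ‖²`). [cite: Waldron2019, Prop. 3.1(a) (k = 1); Waldron2016, Lemma 3.1] -/
theorem integral_sq_mul_gradDensity_le_of_flow_on (b : OrthonormalBasis ι ℝ E)
    {A : ℝ → Connection E (Matrix m m ℂ)} {𝒯 : Set ℝ} (h𝒯 : IsOpen 𝒯)
    (hA : ContDiffOn ℝ ∞ (fun p : ℝ × E => A p.1 p.2) (𝒯 ×ˢ (univ : Set E)))
    (hval : ∀ ⦃s : ℝ⦄, s ∈ 𝒯 → (A s).IsValuedIn (skewAdjoint.submodule ℝ (Matrix m m ℂ)))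
    (hpde : ∀ ⦃s : ℝ⦄, s ∈ 𝒯 → ∀ y w, deriv (fun s' => A s' y w) s = divCurvature (A s) y w)
    {φ : E → ℝ} (hφ : ContDiff ℝ 1 φ) (hφc : HasCompactSupport φ)
    {Kc U : Set E} (hKc : IsCompact Kc) (hUK : U ⊆ Kc) (hU : MeasurableSet U)
    (hφU : ∀ y ∉ U, fderiv ℝ φ y = 0) {K : ℝ} (hK : ∀ y, ‖fderiv ℝ φ y‖ ≤ K)
    {t : ℝ} (ht : t ∈ 𝒯) {S : ℝ}
    (hS : ∀ y, φ y ≠ 0 → Real.sqrt (ymDensityOfBasis b (A t) y) ≤ S) :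
    ∫ y, φ y ^ 2 * ∑ i, ∑ j, ∑ k,
        ‖covDeriv (A t) (fun z => curvature (A t) z (b j) (b k)) y (b i)‖ ^ 2 ≤
      -2 * (∫ y, φ y ^ 2 * deriv (fun s => ymDensityOfBasis b (A s) y) t) +
        8 * K ^ 2 * (∫ y in U, ymDensityOfBasis b (A t) y) +
        2 * (8 * Real.sqrt 2 * (Fintype.card ι : ℝ) ^ 3) * S *
          ∫ y, φ y ^ 2 * ymDensityOfBasis b (A t) y := by
  have hsm : ContDiff ℝ ∞ (A t) := contDiff_slice_of_contDiffOn_prod hA ht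
  have hA3 : ContDiff ℝ 3 (A t) := hsm.of_le (natCast_le_infty₈ 3)
  have hA21 : ContDiff ℝ (2 + 1) (A t) := by
    rw [show (2 : WithTop ℕ∞) + 1 = 3 by norm_num]; exact hA3
  have hA02 : ContDiff ℝ (0 + 2) (A t) := by
    rw [show (0 : WithTop ℕ∞) + 2 = 2 by norm_num]; exact hsm.of_le (natCast_le_infty₈ 2)
  have hA₃0 : 0 ≤ 8 * Real.sqrt 2 * (Fintype.card ι : ℝ) ^ 3 := by positivity
  -- ### continuity of the players
  have he2 : ContDiff ℝ 2 fun y => ymDensityOfBasis b (A t) y := contDiff_ymDensityOfBasis b hA21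
  have hec : Continuous fun y => ymDensityOfBasis b (A t) y := he2.continuous
  have hNc : Continuous fun y => (∑ i, ∑ j, ∑ k, ‖covDeriv (A t) (fun z => curvature (A t) z (b j) (b k)) y (b i)‖ ^ 2) := by
    refine continuous_finsetSum _ fun i _ => continuous_finsetSum _ fun j _ =>
      continuous_finsetSum _ fun k _ => ?_
    exact ((contDiff_covDeriv_curvature_apply hA02 (b j) (b k) (b i)).continuous).norm.pow 2
  have hdec : Continuous fun y => deriv (fun s => ymDensityOfBasis b (A s) y) t := continuous_deriv_ymDensity_tslice b h𝒯 hA ht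
  have hlapc : Continuous fun y => (∑ i, fderiv ℝ (fun z => fderiv ℝ (fun x => ymDensityOfBasis b (A t) x) z (b i)) y (b i)) := by
    refine continuous_finsetSum _ fun i _ => ?_
    have h1 : ContDiff ℝ 1 fun z => fderiv ℝ (fun x => ymDensityOfBasis b (A t) x) z (b i) :=
      (he2.fderiv_right (m := 1) (by norm_num)).clm_apply contDiff_const
    exact (h1.continuous_fderiv one_ne_zero).clm_apply continuous_const
  have hφcont : Continuous φ := hφ.continuous
  have hφ2c : Continuous fun y => φ y ^ 2 := hφcont.pow 2
  have hφ2s : HasCompactSupport fun y => φ y ^ 2 := hasCompactSupport_sq hφc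
  have he0 : ∀ y, 0 ≤ ymDensityOfBasis b (A t) y := fun y => ymDensityOfBasis_nonneg b _ y
  have hN0 : ∀ y, 0 ≤ (∑ i, ∑ j, ∑ k, ‖covDeriv (A t) (fun z => curvature (A t) z (b j) (b k)) y (b i)‖ ^ 2) := fun y =>
    Finset.sum_nonneg fun i _ => Finset.sum_nonneg fun j _ => Finset.sum_nonneg fun k _ => by
      positivity
  -- integrability of `φ² ×` continuous functions
  have hint : ∀ {g : E → ℝ}, Continuous g → Integrable fun y => φ y ^ 2 * g y := fun hg =>
    (hφ2c.mul hg).integrable_of_hasCompactSupport hφ2s.mul_right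
  -- ### the pointwise inequality `φ² ∂ₜe ≤ φ² Δe − φ² N + A₃ S φ² e`
  have hpt : ∀ y, φ y ^ 2 * deriv (fun s => ymDensityOfBasis b (A s) y) t ≤
      φ y ^ 2 * (∑ i, fderiv ℝ (fun z => fderiv ℝ (fun x => ymDensityOfBasis b (A t) x) z (b i)) y (b i)) - φ y ^ 2 * (∑ i, ∑ j, ∑ k, ‖covDeriv (A t) (fun z => curvature (A t) z (b j) (b k)) y (b i)‖ ^ 2) +
        8 * Real.sqrt 2 * (Fintype.card ι : ℝ) ^ 3 * S * (φ y ^ 2 * ymDensityOfBasis b (A t) y) := by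
    intro y
    have hB := deriv_ymDensityOfBasis_sub_laplacian_le b h𝒯 hA hpde ht (hval ht) y
    have hφ2 : 0 ≤ φ y ^ 2 := sq_nonneg _
    by_cases hφy : φ y = 0
    · simp [hφy]
    · have h3 : ymDensityOfBasis b (A t) y * Real.sqrt (ymDensityOfBasis b (A t) y) ≤ S * ymDensityOfBasis b (A t) y := by
        rw [mul_comm S]; exact mul_le_mul_of_nonneg_left (hS y hφy) (he0 y)
      have h4 := mul_le_mul_of_nonneg_left hB hφ2
      have h5 := mul_le_mul_of_nonneg_left (mul_le_mul_of_nonneg_left h3 hA₃0) hφ2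
      linarith only [h4, h5]
  -- ### integrate
  have hI1 : (∫ y, φ y ^ 2 * deriv (fun s => ymDensityOfBasis b (A s) y) t) ≤
      (∫ y, φ y ^ 2 * (∑ i, fderiv ℝ (fun z => fderiv ℝ (fun x => ymDensityOfBasis b (A t) x) z (b i)) y (b i))) - (∫ y, φ y ^ 2 * (∑ i, ∑ j, ∑ k, ‖covDeriv (A t) (fun z => curvature (A t) z (b j) (b k)) y (b i)‖ ^ 2)) +
        8 * Real.sqrt 2 * (Fintype.card ι : ℝ) ^ 3 * S * ∫ y, φ y ^ 2 * ymDensityOfBasis b (A t) y := by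
    have hi1 := hint hlapc
    have hi2 := hint hNc
    have hi3 : Integrable fun y => 8 * Real.sqrt 2 * (Fintype.card ι : ℝ) ^ 3 * S *
        (φ y ^ 2 * ymDensityOfBasis b (A t) y) := (hint hec).const_mul _
    have hi12 : Integrable fun y => φ y ^ 2 * (∑ i, fderiv ℝ (fun z => fderiv ℝ (fun x => ymDensityOfBasis b (A t) x) z (b i)) y (b i)) - φ y ^ 2 * (∑ i, ∑ j, ∑ k, ‖covDeriv (A t) (fun z => curvature (A t) z (b j) (b k)) y (b i)‖ ^ 2) := hi1.sub hi2
    have hsum : Integrable fun y => φ y ^ 2 * (∑ i, fderiv ℝ (fun z => fderiv ℝ (fun x => ymDensityOfBasis b (A t) x) z (b i)) y (b i)) - φ y ^ 2 * (∑ i, ∑ j, ∑ k, ‖covDeriv (A t) (fun z => curvature (A t) z (b j) (b k)) y (b i)‖ ^ 2) +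
        8 * Real.sqrt 2 * (Fintype.card ι : ℝ) ^ 3 * S * (φ y ^ 2 * ymDensityOfBasis b (A t) y) := hi12.add hi3
    have h := integral_mono (hint hdec) hsum hpt
    rw [integral_add hi12 hi3, integral_sub hi1 hi2, MeasureTheory.integral_const_mul] at h
    exact h
  -- `∫ φ² Δe ≤ ½ ∫ φ² N + 4 ∫ e ‖∇φ‖²`
  have hI2 := integral_sq_mul_laplacian_ymDensity_le b hsm (hval ht) hφ hφc
  have hgradc : Continuous fun y => ‖fderiv ℝ φ y‖ ^ 2 :=
    ((hφ.continuous_fderiv one_ne_zero).norm).pow 2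
  have hgrads : HasCompactSupport fun y => ‖fderiv ℝ φ y‖ ^ 2 :=
    hasCompactSupport_norm_sq (hφc.fderiv (𝕜 := ℝ))
  have hig : Integrable fun y => ymDensityOfBasis b (A t) y * ‖fderiv ℝ φ y‖ ^ 2 :=
    (hec.mul hgradc).integrable_of_hasCompactSupport hgrads.mul_left
  have hI2' : (∫ y, φ y ^ 2 * (∑ i, fderiv ℝ (fun z => fderiv ℝ (fun x => ymDensityOfBasis b (A t) x) z (b i)) y (b i))) ≤ 1 / 2 * (∫ y, φ y ^ 2 * (∑ i, ∑ j, ∑ k, ‖covDeriv (A t) (fun z => curvature (A t) z (b j) (b k)) y (b i)‖ ^ 2)) +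
      4 * ∫ y, ymDensityOfBasis b (A t) y * ‖fderiv ℝ φ y‖ ^ 2 := by
    have hsplit : (∫ y, (1 / 2 * φ y ^ 2 * (∑ i, ∑ j, ∑ k, ‖covDeriv (A t) (fun z => curvature (A t) z (b j) (b k)) y (b i)‖ ^ 2) + 4 * ymDensityOfBasis b (A t) y * ‖fderiv ℝ φ y‖ ^ 2)) =
        1 / 2 * (∫ y, φ y ^ 2 * (∑ i, ∑ j, ∑ k, ‖covDeriv (A t) (fun z => curvature (A t) z (b j) (b k)) y (b i)‖ ^ 2)) + 4 * ∫ y, ymDensityOfBasis b (A t) y * ‖fderiv ℝ φ y‖ ^ 2 := by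
      have hi1 : Integrable fun y => 1 / 2 * φ y ^ 2 * (∑ i, ∑ j, ∑ k, ‖covDeriv (A t) (fun z => curvature (A t) z (b j) (b k)) y (b i)‖ ^ 2) := by
        have := (hint hNc).const_mul (1 / 2); simpa only [mul_assoc] using this
      have hi2 : Integrable fun y => 4 * ymDensityOfBasis b (A t) y * ‖fderiv ℝ φ y‖ ^ 2 := by
        have := hig.const_mul 4; simpa only [mul_assoc] using this
      rw [integral_add hi1 hi2, ← MeasureTheory.integral_const_mul,
        ← MeasureTheory.integral_const_mul]
      congr 1
      · exact integral_congr_ae (ae_of_all _ fun y => by ring)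
      · exact integral_congr_ae (ae_of_all _ fun y => by ring)
    rw [← hsplit]
    exact hI2
  -- `∫ e ‖∇φ‖² ≤ K² ∫_U e`
  have hI3 : (∫ y, ymDensityOfBasis b (A t) y * ‖fderiv ℝ φ y‖ ^ 2) ≤ K ^ 2 * ∫ y in U, ymDensityOfBasis b (A t) y := by
    have hzero : ∀ y ∉ U, ymDensityOfBasis b (A t) y * ‖fderiv ℝ φ y‖ ^ 2 = 0 := fun y hy => by
      rw [hφU y hy, norm_zero]; ring
    rw [← setIntegral_eq_integral_of_forall_compl_eq_zero hzero, ← integral_const_mul]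
    refine setIntegral_mono_on ((hig.integrableOn))
      (((continuous_const.mul hec).continuousOn.integrableOn_compact hKc).mono_set hUK) hU
      fun y _ => ?_
    have h1 : ‖fderiv ℝ φ y‖ ^ 2 ≤ K ^ 2 := pow_le_pow_left₀ (norm_nonneg _) (hK y) 2
    calc ymDensityOfBasis b (A t) y * ‖fderiv ℝ φ y‖ ^ 2 ≤ ymDensityOfBasis b (A t) y * K ^ 2 := mul_le_mul_of_nonneg_left h1 (he0 y)
      _ = K ^ 2 * ymDensityOfBasis b (A t) y := mul_comm _ _
  -- ### assemble
  linarith only [hI1, hI2', hI3]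

/-- **The localized space-time `L²` bound for `∇F`.** Along a jointly smooth `𝔲(m)`-valued
solution of the Yang–Mills heat equation on the open time set `𝒯 ⊇ [t₁, t₂]`, for a `C¹`
compactly supported cut-off `φ` with `‖∇φ‖ ≤ K`, `∇φ = 0` off the measurable `U ⊆ K_c`
(compact), and `√e ≤ S` on `[t₁,t₂] × {φ ≠ 0}`: with `N = ∑_{ijk}‖DᵢF_{jk}‖²`, `A₃ = 8√2(card ι)³`,
`∫_{t₁}^{t₂}∫ φ²N ≤ 2∫ φ²e(t₁) + 8K² ∫_{t₁}^{t₂}∫_U e + 2A₃S ∫_{t₁}^{t₂}∫ φ²e`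
(the fixed-time inequality integrated in time; `∫_{t₁}^{t₂} (d/dt)∫φ²e = ∫φ²e(t₂) − ∫φ²e(t₁)`,
`∫φ²e(t₂) ≥ 0`). [cite: Waldron2019, Prop. 3.1(a) (k = 1); Waldron2016, Lemma 3.1] -/
theorem intervalIntegral_integral_sq_mul_gradDensity_le (b : OrthonormalBasis ι ℝ E)
    {A : ℝ → Connection E (Matrix m m ℂ)} {𝒯 : Set ℝ} (h𝒯 : IsOpen 𝒯)
    (hA : ContDiffOn ℝ ∞ (fun p : ℝ × E => A p.1 p.2) (𝒯 ×ˢ (univ : Set E)))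
    (hval : ∀ ⦃s : ℝ⦄, s ∈ 𝒯 → (A s).IsValuedIn (skewAdjoint.submodule ℝ (Matrix m m ℂ)))
    (hpde : ∀ ⦃s : ℝ⦄, s ∈ 𝒯 → ∀ y w, deriv (fun s' => A s' y w) s = divCurvature (A s) y w)
    {φ : E → ℝ} (hφ : ContDiff ℝ 1 φ) (hφc : HasCompactSupport φ)
    {Kc U : Set E} (hKc : IsCompact Kc) (hUK : U ⊆ Kc) (hU : MeasurableSet U)
    (hφU : ∀ y ∉ U, fderiv ℝ φ y = 0) {K : ℝ} (hK : ∀ y, ‖fderiv ℝ φ y‖ ≤ K)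
    {t₁ t₂ : ℝ} (h12 : t₁ ≤ t₂) (hI : Icc t₁ t₂ ⊆ 𝒯) {S : ℝ}
    (hS : ∀ s ∈ Icc t₁ t₂, ∀ y, φ y ≠ 0 → Real.sqrt (ymDensityOfBasis b (A s) y) ≤ S) :
    ∫ s in t₁..t₂, ∫ y, φ y ^ 2 * ∑ i, ∑ j, ∑ k,
        ‖covDeriv (A s) (fun z => curvature (A s) z (b j) (b k)) y (b i)‖ ^ 2 ≤
      2 * (∫ y, φ y ^ 2 * ymDensityOfBasis b (A t₁) y) +
        8 * K ^ 2 * (∫ s in t₁..t₂, ∫ y in U, ymDensityOfBasis b (A s) y) +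
        2 * (8 * Real.sqrt 2 * (Fintype.card ι : ℝ) ^ 3) * S *
          ∫ s in t₁..t₂, ∫ y, φ y ^ 2 * ymDensityOfBasis b (A s) y := by
  have hO : IsOpen (𝒯 ×ˢ (univ : Set E)) := h𝒯.prod isOpen_univ
  have hφcont : Continuous φ := hφ.continuous
  have hφ2c : Continuous fun y => φ y ^ 2 := hφcont.pow 2
  have hφ2s : HasCompactSupport fun y => φ y ^ 2 := hasCompactSupport_sq hφc
  set A₃ : ℝ := 8 * Real.sqrt 2 * (Fintype.card ι : ℝ) ^ 3 with hA₃
  -- ### the slab-continuous integrands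
  have he := contDiffOn_ymDensityOfBasis_joint_infty b h𝒯 hA
  have he_c : ContinuousOn (fun p : ℝ × E => ymDensityOfBasis b (A p.1) p.2) (𝒯 ×ˢ (univ : Set E)) :=
    he.continuousOn
  have hN_c : ContinuousOn (fun p : ℝ × E => ∑ i, ∑ j, ∑ k,
      ‖covDeriv (A p.1) (fun z => curvature (A p.1) z (b j) (b k)) p.2 (b i)‖ ^ 2)
      (𝒯 ×ˢ (univ : Set E)) :=
    (ContDiffOn.sum fun i _ => ContDiffOn.sum fun j _ => ContDiffOn.sum fun k _ =>
      (contDiffOn_covDeriv_curvature_joint h𝒯 hA (b j) (b k) (b i)).norm_sq ℝ).continuousOn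
  set rate : ℝ × E → ℝ := fun p => fderiv ℝ (fun q : ℝ × E => ymDensityOfBasis b (A q.1) q.2) p
    ((1 : ℝ), (0 : E)) with hrate
  have hrate_c : ContinuousOn rate (𝒯 ×ˢ (univ : Set E)) :=
    ((ContinuousLinearMap.apply ℝ ℝ ((1 : ℝ), (0 : E))).continuous.comp_continuousOn
      (he.continuousOn_fderiv_of_isOpen hO (by simp)))
  have hrate_eq : ∀ {s : ℝ}, s ∈ 𝒯 → ∀ y,
      deriv (fun s' => ymDensityOfBasis b (A s') y) s = rate (s, y) := fun hs y =>
    (hasDerivAt_timeSlice hO he (by simp) ⟨hs, mem_univ y⟩).deriv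
  -- ### the time functions
  set Y : ℝ → ℝ := fun s => ∫ y, φ y ^ 2 * ymDensityOfBasis b (A s) y with hY
  set D : ℝ → ℝ := fun s => ∫ y, φ y ^ 2 * deriv (fun s' => ymDensityOfBasis b (A s') y) s with hD
  set G : ℝ → ℝ := fun s => ∫ y, φ y ^ 2 * ∑ i, ∑ j, ∑ k,
    ‖covDeriv (A s) (fun z => curvature (A s) z (b j) (b k)) y (b i)‖ ^ 2 with hG
  set EU : ℝ → ℝ := fun s => ∫ y in U, ymDensityOfBasis b (A s) y with hEU
  have hYc : ContinuousOn Y 𝒯 :=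
    continuousOn_integral_mul_of_continuousOn_slab h𝒯 he_c hφ2c hφ2s
  have hGc : ContinuousOn G 𝒯 :=
    continuousOn_integral_mul_of_continuousOn_slab h𝒯 hN_c hφ2c hφ2s
  have hEUc : ContinuousOn EU 𝒯 :=
    continuousOn_setIntegral_of_continuousOn_slab h𝒯 he_c hKc hUK hU
  have hDc : ContinuousOn D 𝒯 := by
    have h := continuousOn_integral_mul_of_continuousOn_slab h𝒯 hrate_c hφ2c hφ2s
    refine h.congr fun s hs => ?_
    simp only [hD]
    exact integral_congr_ae (ae_of_all _ fun y => by simp only [hrate_eq hs y])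
  -- the derivative of `Y`
  have hYd : ∀ s ∈ 𝒯, HasDerivAt Y (D s) s := fun s hs =>
    hasDerivAt_integral_mul_ymDensity_of_isOpen b h𝒯 hA hφ2c hφ2s hs
  -- ### the fixed-time inequality on `[t₁, t₂]`
  have hfix : ∀ s ∈ Icc t₁ t₂, G s ≤ -2 * D s + 8 * K ^ 2 * EU s + 2 * A₃ * S * Y s := fun s hs =>
    integral_sq_mul_gradDensity_le_of_flow_on b h𝒯 hA hval hpde hφ hφc hKc hUK hU hφU hK (hI hs)
      (hS s hs)
  -- ### integrate in time
  have hIi : ∀ {f : ℝ → ℝ}, ContinuousOn f 𝒯 → IntervalIntegrable f volume t₁ t₂ := fun hf =>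
    ContinuousOn.intervalIntegrable (by rw [uIcc_of_le h12]; exact hf.mono hI)
  have hGi := hIi hGc
  have hDi := hIi hDc
  have hEUi := hIi hEUc
  have hYi := hIi hYc
  have hRi : IntervalIntegrable (fun s => -2 * D s + 8 * K ^ 2 * EU s + 2 * A₃ * S * Y s) volume
      t₁ t₂ := ((hDi.const_mul (-2)).add (hEUi.const_mul (8 * K ^ 2))).add (hYi.const_mul (2 * A₃ * S))
  have hmono := intervalIntegral.integral_mono_on h12 hGi hRi hfix
  have hsplit : (∫ s in t₁..t₂, (-2 * D s + 8 * K ^ 2 * EU s + 2 * A₃ * S * Y s)) =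
      -2 * (∫ s in t₁..t₂, D s) + 8 * K ^ 2 * (∫ s in t₁..t₂, EU s) +
        2 * A₃ * S * ∫ s in t₁..t₂, Y s := by
    rw [intervalIntegral.integral_add ((hDi.const_mul (-2)).add (hEUi.const_mul (8 * K ^ 2)))
      (hYi.const_mul (2 * A₃ * S)), intervalIntegral.integral_add (hDi.const_mul (-2))
      (hEUi.const_mul (8 * K ^ 2)), intervalIntegral.integral_const_mul,
      intervalIntegral.integral_const_mul, intervalIntegral.integral_const_mul]
  -- the fundamental theorem of calculus for `Y`
  have hFTC : (∫ s in t₁..t₂, D s) = Y t₂ - Y t₁ :=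
    intervalIntegral.integral_eq_sub_of_hasDerivAt
      (fun s hs => hYd s (hI (by rwa [uIcc_of_le h12] at hs))) hDi
  have hY2 : 0 ≤ Y t₂ := integral_nonneg fun y => mul_nonneg (sq_nonneg _)
    (ymDensityOfBasis_nonneg b _ y)
  rw [hsplit, hFTC] at hmono
  simp only [hG, hY, hEU] at hmono ⊢
  linarith only [hmono, hY2]

end GradEnergy

end Literature.MathematicalPhysics.QuantumLattice
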